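import Summits.QuantumAdvantage.QuantumAdvantage.Theorems.LinnikCubicClassGroupsDegreeOnePrimesEscapeResidueAnalysis
import Literature.NumberTheory.LFunctions.DedekindZetaRealAxisBounds
import Literature.NumberTheory.LFunctions.StarkExceptionalZeroProofs
import Literature.NumberTheory.LFunctions.StarkHadamardPositivity
import HarnessLib

/-!
# Landau's UPPER bound, effective and explicit: `κ_K ≤ 2^{n+1}√e · log^{n−1}|d_K|` and
# `h_K · R_K ≤ 2√e · w_K · √|d_K| · log^{n−1}|d_K|` for EVERY number field of degree `n ≥ 2`

Topic `Summits/QuantumAdvantage/QuantumAdvantage/Theorems`, helper file of the (closed) crux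
`DegreeOnePrimesEscape` (stmt-QuantumAdvantage-11543) of route `LinnikCubicClassGroups`; cell B2b-1
(linnik-cubic), PART B.  HONEST FRAMING: the value of this file is a THEOREM — a kernel-checked
reproduction, with explicit constants, of the classical upper bound of Landau (1918) in Louboutin's form
— NOT summit progress.  Everything here is PROVED (theorems only, standard axioms).  It supersedes the
exponent-`3/2` bound of `Literature/NumberTheory/NumberFields/ClassNumberRegulatorUpperBound.lean`.

Notation: `n = [K:ℚ] ≥ 2`, `d = |d_K| ≥ 3`, `L = log d`, `κ_K = Res_{s=1} ζ_K`, `w_K` = number of roots of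
unity, `h_K`, `R_K`.

* `norm_apply_one_le_of_symmetric` — for an entire `F` with `F(1−s) = F(s)`, order `< 2`, all zeros in
  `Re s ≤ 1` and `F(1) ≠ 0`: `‖F(1)‖ ≤ ‖F(σ)‖` for every real `σ ≥ 1` (`Re F'/F ≥ 0` right of `1`, tree
  `Stark1974.re_logDeriv_nonneg_of_symmetric`, integrated by the mean value inequality
  `Residue.log_norm_sub_le`).
* `residue_le_log_pow` — **`κ_K ≤ 2^{n+1} · e^{1/2} · L^{n−1}`**: apply the monotonicity to Stark's
  completion `ξ_K(s) = s ζ₁_K(s) γ_K(s)` (`exists_starkXi`): `κ_K ‖γ_K(1)‖ = ‖ξ_K(1)‖ ≤ ‖ξ_K(σ)‖ =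
  σ ‖ζ₁_K(σ)‖ ‖γ_K(σ)‖ ≤ σ (σ−1)(σ/(σ−1))^n · d^{(σ−1)/2} ‖γ_K(1)‖`
  (`norm_dedekindZeta₁_ofReal_le`, `norm_dedekindGammaFactor_le_rpow_mul`), at `σ = 1 + 1/L`.
* `classNumber_mul_regulator_le_sqrt_mul_log_pow` — **`h_K R_K ≤ 2 e^{1/2} · w_K · √d · L^{n−1}`** by the
  class number formula `κ_K = 2^{r₁}(2π)^{r₂} h_K R_K/(w_K √d)` (Mathlib) and `2^{r₁}(2π)^{r₂} ≥ 2^n`.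
* `classNumber_mul_regulator_le_of_odd'` — odd degree (`w_K = 2`): `h_K R_K ≤ 4 e^{1/2} √d L^{n−1}`;
  `classNumber_mul_regulator_le_cubic` — every cubic field: `h_K R_K ≤ 7 √|d_K| log²|d_K|`.

PLACEMENT: Landau 1918 (`h R ≪_n √d log^{n−1} d`); Louboutin, J. Number Theory 85 (2000) Thm 1 /
Bordellès 2020 Thm 7.23 (`h R ≤ (w/2)(2/π)^{r₂}(e log d/(2√2(n−1)))^{n−1}√d`, sharper in `n`); ours follows
Louboutin's route (monotonicity of `ξ_K` instead of his integral representation) with cruder constants.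
DELTA: none mathematically — kernel-checked, explicit, every number field.

## References
* E. Landau, Gött. Nachr. (1918) 79–97 / 478–488 (upper bounds for `h R`).
* S. Louboutin, *Explicit bounds for residues of Dedekind zeta functions, values of L-functions at s = 1,
  and relative class numbers*, J. Number Theory 85 (2000) 263–282, Thm 1. [Louboutin2000]
* O. Bordellès, *Arithmetic Tales. Advanced Edition* (2020), Thm 7.23. [Bordelles2020]
* H. M. Stark, Invent. Math. 23 (1974) 135–152, §2 (the completion `ξ_K` and `Re ξ'/ξ`). [Stark1974]
-/

noncomputable section

open NumberField NumberField.InfinitePlace NumberField.Units Complex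

namespace Summit.QuantumAdvantage.QuantumAdvantage.Theorems.DegreeOnePrimesEscape

namespace Residue

open Literature.NumberTheory.LFunctions Literature.NumberTheory.LFunctions.NumberField
  Literature.NumberTheory.LFunctions.Stark1974

/-! ### Monotonicity of a symmetric entire function right of `1` -/

/-- **`‖F(1)‖ ≤ ‖F(σ)‖` for `σ ≥ 1`**, for `F` entire with `F(1 − s) = F(s)`, `‖F(s)‖ ≤ C exp(‖s‖^μ)`
(`μ < 2`), all zeros in `Re s ≤ 1`, and `F(1) ≠ 0`: `(log ‖F‖)' = Re F'/F ≥ 0` on `(1, ∞)` (Hadamard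
product, `re_logDeriv_nonneg_of_symmetric`) and the mean value inequality. [cite: Stark1974, §2 eq. (9)] -/
theorem norm_apply_one_le_of_symmetric {F : ℂ → ℂ} (hF : Differentiable ℂ F)
    (hsymm : ∀ s, F (1 - s) = F s) {C μ : ℝ} (hμ : μ < 2) (hμ0 : 0 ≤ μ)
    (hgrowth : ∀ s, ‖F s‖ ≤ C * Real.exp (‖s‖ ^ μ)) (hzero : ∀ s, F s = 0 → s.re ≤ 1)
    (hF1 : F 1 ≠ 0) {σ : ℝ} (hσ : 1 ≤ σ) : ‖F 1‖ ≤ ‖F σ‖ := by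
  -- the reflected function `g(s) = F(1 + σ − s)` on the segment `[1, σ]`
  set g : ℂ → ℂ := fun s ↦ F (((1 + σ : ℝ) : ℂ) - s) with hg
  have hgd : Differentiable ℂ g := hF.comp ((differentiable_const _).sub differentiable_id)
  have hFne : ∀ τ : ℝ, 1 ≤ τ → F τ ≠ 0 := by
    intro τ hτ h0
    rcases eq_or_lt_of_le hτ with h | h
    · apply hF1
      rw [show (1 : ℂ) = ((1 : ℝ) : ℂ) by simp, h]
      exact h0
    · have := hzero _ h0
      simp at this
      linarith
  have hne : ∀ t : ℝ, 1 ≤ t → t ≤ σ → g t ≠ 0 := by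
    intro t h1 h2
    simp only [hg]
    rw [show ((1 + σ : ℝ) : ℂ) - (t : ℂ) = ((1 + σ - t : ℝ) : ℂ) by push_cast; ring]
    exact hFne _ (by linarith)
  have hM : ∀ t : ℝ, 1 < t → t < σ → (deriv g t / g t).re ≤ 0 := by
    intro t h1 h2
    have hd : deriv g t = -deriv F (((1 + σ : ℝ) : ℂ) - t) := by
      simp only [hg]
      exact deriv_comp_const_sub F _ _
    have hpt : ((1 + σ : ℝ) : ℂ) - (t : ℂ) = ((1 + σ - t : ℝ) : ℂ) := by push_cast; ring
    have hpos := re_logDeriv_nonneg_of_symmetric hF hsymm hμ hμ0 hgrowth hzero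
      (σ := 1 + σ - t) (by linarith)
    rw [logDeriv_apply, ← hpt] at hpos
    simp only [hg]
    rw [hd, neg_div, Complex.neg_re]
    linarith
  have h := log_norm_sub_le hgd hσ hne hM
  have hgσ : g σ = F 1 := by
    simp only [hg]; congr 1; push_cast; ring
  have hg1 : g ((1 : ℝ) : ℂ) = F σ := by
    simp only [hg]; congr 1; push_cast; ring
  rw [hgσ, hg1, zero_mul, sub_nonpos] at h
  have hFσ : F σ ≠ 0 := hFne σ hσ
  exact (Real.log_le_log_iff (norm_pos_iff.mpr hF1) (norm_pos_iff.mpr hFσ)).mp h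

/-! ### The residue -/

/-- **Landau's upper bound for the residue, explicit**: for every number field `K` of degree `n ≥ 2`,
`κ_K ≤ 2^{n+1} · e^{1/2} · (log|d_K|)^{n−1}`.  Proof: monotonicity of Stark's completion `ξ_K` on
`[1, σ]`, `σ = 1 + 1/log|d_K|`, with `ζ_K(σ) ≤ (σ/(σ−1))^n` and `‖γ_K(σ)‖ ≤ |d_K|^{(σ−1)/2}‖γ_K(1)‖`.
[cite: Louboutin2000, Thm 1 (method; cruder constant)] -/
theorem residue_le_log_pow (K : Type) [Field K] [NumberField K] (hn : 1 < Module.finrank ℚ K) :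
    dedekindZeta_residue K ≤
      2 ^ (Module.finrank ℚ K + 1) * Real.exp (1 / 2) *
        Real.log ((discr K).natAbs : ℝ) ^ (Module.finrank ℚ K - 1) := by
  classical
  set n : ℕ := Module.finrank ℚ K with hndef
  set d : ℝ := ((discr K).natAbs : ℝ) with hd
  have hd3 : (3 : ℝ) ≤ d := by
    have h2 := NumberField.abs_discr_gt_two hn
    rw [hd, Nat.cast_natAbs]
    exact_mod_cast (show (3 : ℤ) ≤ |discr K| by omega)
  have hd0 : 0 < d := by linarith
  set L : ℝ := Real.log d with hL
  have hL1 : 1 < L := by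
    rw [hL, Real.lt_log_iff_exp_lt hd0]
    have := Real.exp_one_lt_d9; linarith
  have hL0 : 0 < L := by linarith
  set σ : ℝ := 1 + 1 / L with hσ
  have hσ1 : 1 < σ := by rw [hσ]; have := one_div_pos.mpr hL0; linarith
  have hσ2 : σ ≤ 2 := by
    rw [hσ]; have : 1 / L ≤ 1 := (div_le_one hL0).mpr hL1.le; linarith
  have hσm1 : σ - 1 = 1 / L := by rw [hσ]; ring
  -- Stark's completion
  obtain ⟨ξ, hdiff, hsymm, ⟨C, hC⟩, hpos⟩ := exists_starkXi K
  have hzeroξ : ∀ s, ξ s = 0 → s.re ≤ 1 := fun s hs ↦ (xi_zero hsymm hpos hs).2.1.le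
  have hκ0 : 0 < dedekindZeta_residue K := dedekindZeta_residue_pos K
  have hγ1pos : 0 < ‖dedekindGammaFactor K 1‖ :=
    norm_pos_iff.mpr (dedekindGammaFactor_ne_zero_of_re_pos (by simp))
  have hξ1 : ‖ξ 1‖ = dedekindZeta_residue K * ‖dedekindGammaFactor K 1‖ := by
    rw [hpos 1 (by simp), one_mul, norm_mul, dedekindZeta₁_apply_one, Complex.norm_real,
      Real.norm_of_nonneg hκ0.le]
  have hξ1ne : ξ 1 ≠ 0 := by
    rw [← norm_pos_iff, hξ1]; positivity
  -- monotonicity: `‖ξ 1‖ ≤ ‖ξ σ‖`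
  have hmono := norm_apply_one_le_of_symmetric hdiff hsymm (by norm_num : (15 / 8 : ℝ) < 2) (by norm_num)
    hC hzeroξ hξ1ne hσ1.le
  -- `‖ξ σ‖ ≤ σ (σ − 1) (σ/(σ−1))^n d^{(σ−1)/2} ‖γ(1)‖`
  have hξσ : ‖ξ σ‖ ≤ σ * ((σ - 1) * (σ / (σ - 1)) ^ n) * (d ^ ((σ - 1) / 2) * ‖dedekindGammaFactor K 1‖) := by
    rw [hpos σ (by simp; linarith), norm_mul, norm_mul, Complex.norm_real, Real.norm_of_nonneg (by linarith)]
    have h1 : ‖dedekindZeta₁ K σ‖ ≤ (σ - 1) * (σ / (σ - 1)) ^ n := norm_dedekindZeta₁_ofReal_le K hσ1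
    have h2 : ‖dedekindGammaFactor K σ‖ ≤ d ^ ((σ - 1) / 2) * ‖dedekindGammaFactor K 1‖ :=
      norm_dedekindGammaFactor_le_rpow_mul K hσ1.le hσ2
    have hσ0 : (0 : ℝ) ≤ σ := by linarith
    exact mul_le_mul (mul_le_mul_of_nonneg_left h1 hσ0) h2 (norm_nonneg _) (by positivity)
  -- the elementary evaluation at `σ = 1 + 1/L`
  have hpow : (σ / (σ - 1)) ^ n = σ ^ n * L ^ n := by
    rw [hσm1, ← mul_pow]; congr 1; field_simp
  have hdexp : d ^ ((σ - 1) / 2) = Real.exp (1 / 2) := by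
    rw [Real.rpow_def_of_pos hd0, ← hL, hσm1]
    congr 1
    field_simp
  have hn1 : n = (n - 1) + 1 := by omega
  have heval : σ * ((σ - 1) * (σ / (σ - 1)) ^ n) * d ^ ((σ - 1) / 2) =
      σ ^ (n + 1) * Real.exp (1 / 2) * L ^ (n - 1) := by
    rw [hpow, hdexp, hσm1]
    have hLn : L ^ n = L ^ (n - 1) * L := by
      conv_lhs => rw [hn1]
      rw [pow_succ]
    rw [hLn, pow_succ]
    field_simp
  have hσpow : σ ^ (n + 1) ≤ 2 ^ (n + 1) := pow_le_pow_left₀ (by linarith) hσ2 _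
  -- conclude: divide by `‖γ(1)‖ > 0`
  have hmain : dedekindZeta_residue K * ‖dedekindGammaFactor K 1‖ ≤
      (σ ^ (n + 1) * Real.exp (1 / 2) * L ^ (n - 1)) * ‖dedekindGammaFactor K 1‖ := by
    rw [← hξ1, ← heval]
    calc ‖ξ 1‖ ≤ ‖ξ σ‖ := hmono
      _ ≤ σ * ((σ - 1) * (σ / (σ - 1)) ^ n) * (d ^ ((σ - 1) / 2) * ‖dedekindGammaFactor K 1‖) := hξσ
      _ = σ * ((σ - 1) * (σ / (σ - 1)) ^ n) * d ^ ((σ - 1) / 2) * ‖dedekindGammaFactor K 1‖ := by ring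
  have h := le_of_mul_le_mul_right hmain hγ1pos
  refine h.trans ?_
  have hLpos : 0 ≤ L ^ (n - 1) := pow_nonneg hL0.le _
  exact mul_le_mul_of_nonneg_right (mul_le_mul_of_nonneg_right hσpow (Real.exp_pos _).le) hLpos

/-! ### The class number times the regulator -/

/-- **`h_K · R_K ≤ 2 e^{1/2} · w_K · √|d_K| · (log|d_K|)^{n−1}`** for every number field `K` of degree
`n ≥ 2`: the residue bound and Mathlib's class number formula
`κ_K = 2^{r₁}(2π)^{r₂} h_K R_K / (w_K √|d_K|)`, with `2^{r₁}(2π)^{r₂} ≥ 2^{r₁ + 2r₂} = 2^n`.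
[cite: Louboutin2000, Thm 1 (cruder constant)] -/
theorem classNumber_mul_regulator_le_sqrt_mul_log_pow (K : Type) [Field K] [NumberField K]
    (hn : 1 < Module.finrank ℚ K) :
    (classNumber K : ℝ) * regulator K ≤
      2 * Real.exp (1 / 2) * torsionOrder K * Real.sqrt |(discr K : ℝ)| *
        Real.log |(discr K : ℝ)| ^ (Module.finrank ℚ K - 1) := by
  set n : ℕ := Module.finrank ℚ K with hndef
  have hκ := residue_le_log_pow K hn
  rw [← hndef] at hκ
  have hdabs : ((discr K).natAbs : ℝ) = |(discr K : ℝ)| := by rw [Nat.cast_natAbs, Int.cast_abs]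
  rw [hdabs] at hκ
  -- sizes
  have hd0 : 0 < |(discr K : ℝ)| := abs_pos.mpr (Int.cast_ne_zero.mpr (discr_ne_zero K))
  have hd3 : (3 : ℝ) ≤ |(discr K : ℝ)| := by
    have h2 := NumberField.abs_discr_gt_two hn
    rw [← Int.cast_abs]; exact_mod_cast (show (3 : ℤ) ≤ |discr K| by omega)
  have hlog0 : 0 < Real.log |(discr K : ℝ)| := Real.log_pos (by linarith)
  have hsqrt0 : 0 < Real.sqrt |(discr K : ℝ)| := Real.sqrt_pos.mpr hd0
  have hw0 : (0 : ℝ) < torsionOrder K := by exact_mod_cast torsionOrder_pos K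
  have hR0 : 0 < regulator K := regulator_pos K
  have hh0 : (0 : ℝ) < classNumber K := by exact_mod_cast classNumber_pos K
  -- the archimedean factor `A = 2^{r₁}(2π)^{r₂} ≥ 2^n`
  set A : ℝ := (2 : ℝ) ^ nrRealPlaces K * (2 * Real.pi) ^ nrComplexPlaces K with hAdef
  have hA : (2 : ℝ) ^ n ≤ A := by
    have hrk : nrRealPlaces K + 2 * nrComplexPlaces K = n := by
      rw [hndef]; exact card_add_two_mul_card_eq_rank K
    have h4 : (4 : ℝ) ≤ 2 * Real.pi := by linarith [Real.pi_gt_three]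
    calc (2 : ℝ) ^ n = 2 ^ nrRealPlaces K * (2 ^ 2) ^ nrComplexPlaces K := by
          rw [← hrk, pow_add, pow_mul]
      _ ≤ 2 ^ nrRealPlaces K * (2 * Real.pi) ^ nrComplexPlaces K := by
          apply mul_le_mul_of_nonneg_left _ (by positivity)
          exact pow_le_pow_left₀ (by norm_num) (by norm_num at h4 ⊢; linarith) _
  have hA0 : 0 < A := lt_of_lt_of_le (by positivity) hA
  have h2n : (0 : ℝ) < 2 ^ n := by positivity
  -- class number formula: `h R = κ · w √|d| / A`
  have hhR : (classNumber K : ℝ) * regulator K =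
      dedekindZeta_residue K * (torsionOrder K * Real.sqrt |(discr K : ℝ)|) / A := by
    rw [dedekindZeta_residue_def, ← hAdef]
    field_simp
  rw [hhR, div_le_iff₀ hA0]
  have hB0 : 0 ≤ 2 * Real.exp (1 / 2) * torsionOrder K * Real.sqrt |(discr K : ℝ)| *
      Real.log |(discr K : ℝ)| ^ (n - 1) := by positivity
  calc dedekindZeta_residue K * (torsionOrder K * Real.sqrt |(discr K : ℝ)|)
      ≤ 2 ^ (n + 1) * Real.exp (1 / 2) * Real.log |(discr K : ℝ)| ^ (n - 1) *
          (torsionOrder K * Real.sqrt |(discr K : ℝ)|) :=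
        mul_le_mul_of_nonneg_right hκ (by positivity)
    _ = 2 * Real.exp (1 / 2) * torsionOrder K * Real.sqrt |(discr K : ℝ)| *
          Real.log |(discr K : ℝ)| ^ (n - 1) * 2 ^ n := by rw [pow_succ]; ring
    _ ≤ 2 * Real.exp (1 / 2) * torsionOrder K * Real.sqrt |(discr K : ℝ)| *
          Real.log |(discr K : ℝ)| ^ (n - 1) * A := mul_le_mul_of_nonneg_left hA hB0

/-- **Odd degree `n ≥ 3`**: `w_K = 2`, so `h_K · R_K ≤ 4 e^{1/2} · √|d_K| · (log|d_K|)^{n−1}`. [cite: Louboutin2000, Thm 1 (cruder constant)] -/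
theorem classNumber_mul_regulator_le_of_odd' (K : Type) [Field K] [NumberField K]
    (hn : 1 < Module.finrank ℚ K) (hodd : Odd (Module.finrank ℚ K)) :
    (classNumber K : ℝ) * regulator K ≤
      4 * Real.exp (1 / 2) * Real.sqrt |(discr K : ℝ)| * Real.log |(discr K : ℝ)| ^ (Module.finrank ℚ K - 1) := by
  have h := classNumber_mul_regulator_le_sqrt_mul_log_pow K hn
  have hw : (torsionOrder K : ℝ) = 2 := by exact_mod_cast torsionOrder_eq_two_of_odd_finrank hodd
  rw [hw] at h
  calc _ ≤ _ := h
    _ = _ := by ring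

/-- **Every cubic field**: `h_K · R_K ≤ 7 · √|d_K| · (log|d_K|)²` (`4 e^{1/2} < 7`). [cite: Louboutin2000, Thm 1 (cruder constant)] -/
theorem classNumber_mul_regulator_le_cubic (K : Type) [Field K] [NumberField K]
    (hK : Module.finrank ℚ K = 3) :
    (classNumber K : ℝ) * regulator K ≤ 7 * Real.sqrt |(discr K : ℝ)| * Real.log |(discr K : ℝ)| ^ 2 := by
  have hodd : Odd (Module.finrank ℚ K) := by rw [hK]; exact ⟨1, by norm_num⟩
  have h := classNumber_mul_regulator_le_of_odd' K (by rw [hK]; norm_num) hodd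
  rw [hK] at h
  have he : Real.exp (1 / 2) < 7 / 4 := by
    have h1 : Real.exp (1 / 2) ^ 2 = Real.exp 1 := by rw [← Real.exp_nat_mul]; norm_num
    have h2 := Real.exp_one_lt_d9
    nlinarith [Real.exp_pos (1 / 2 : ℝ)]
  have hq : 0 ≤ Real.sqrt |(discr K : ℝ)| * Real.log |(discr K : ℝ)| ^ 2 := by positivity
  have hprod := mul_nonneg (sub_nonneg.mpr he.le) hq
  calc (classNumber K : ℝ) * regulator K
      ≤ 4 * Real.exp (1 / 2) * Real.sqrt |(discr K : ℝ)| * Real.log |(discr K : ℝ)| ^ (3 - 1) := h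
    _ = 4 * Real.exp (1 / 2) * (Real.sqrt |(discr K : ℝ)| * Real.log |(discr K : ℝ)| ^ 2) := by norm_num; ring
    _ ≤ 7 * (Real.sqrt |(discr K : ℝ)| * Real.log |(discr K : ℝ)| ^ 2) := by nlinarith [hprod]
    _ = 7 * Real.sqrt |(discr K : ℝ)| * Real.log |(discr K : ℝ)| ^ 2 := by ring

end Residue

end Summit.QuantumAdvantage.QuantumAdvantage.Theorems.DegreeOnePrimesEscape

end
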